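import Literature.MathematicalPhysics.KineticTheory.LanfordCollisionEstimates
import Literature.MathematicalPhysics.KineticTheory.LanfordClassBounds
import HarnessLib

/-!
# Uniqueness of mild hard-sphere Boltzmann solutions in Lanford's weighted `L^∞` class

(Topic MathematicalPhysics/KineticTheory; third layer of the proof of the named fact
`Literature.MathematicalPhysics.KineticTheory.ukai_lanford_bound`.)

**Theorem** (`hardSphere_mild_unique`). Let `f, g` be two mild solutions of the hard-sphere
Boltzmann equation on the torus `T^d` on `[0, T]`
(`Literature.Analysis.FluidPDE.IsMildBoltzmannSolutionOn T (Torus.geometry d) hardSphereKernel`),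
with continuous time slices and a common Gaussian bound `|f(t)|, |g(t)| ≤ N e^{-β|v|²/2}` on
`[0, T]`, `β > 0`. If `f(0) = g(0)` then `f(t) = g(t)` for every `t ∈ [0, T]`.

This is uniqueness in the WIDE class `L^∞([0,T]; X_β)` — not only in the scale spaces
`sup_t ‖f(t)‖_{β₀ - λt} < ∞` in which the solution is constructed (Gallagher–Saint-Raymond–Texier
2013, Part I Ch. 2 §3.1 Thm 1 "unique continuous solution"; Part II Ch. 5 Thm 7 for the
hierarchy) — and is what makes the a priori bound `ukai_lanford_bound` (stated for every mild
solution in `C([0,T]; X_{β₀/2})`) a consequence of the existence theory. The proof is Ukai's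
decaying-weight trick (GST 2013 Part II Ch. 5, Def. 5.1.4, §5.4) run on the DIFFERENCE
`h = f - g` at weights BELOW `β`: on a short step `[t₁, t₁ + δ²]` put `γ(t) = β - (β/2)(t - t₁)`
and `M = sup e^{γ(t)|v|²/2} |h(t, x, v)|` (finite: `≤ 2N`). Duhamel's formula read at the foot
of the characteristic through `(t, x, v)`, the Gaussian Lipschitz estimate
`|Q(f,f) - Q(g,g)| ≤ C N M (1 + |v|) e^{-γ(τ)|v|²/2}`
(`collisionOpWith_lipschitz_gaussian`) and the weight computation
`∫_{t₁}^t (1 + |v|) e^{-γ(τ)|v|²/2} dτ ≤ (s + (2s/κ)^{1/2}) e^{-γ(t)|v|²/2}`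
(`intervalIntegral_weight_le`) give `M ≤ C N δ (1 + (4/β)^{1/2}) M ≤ M/2`, so `M = 0`; the steps
are iterated (`hardSphere_mild_unique_step`, induction on the number of steps). The step length
`δ²` depends only on `(d, β, N)`.

No definitions are introduced.

## References

* I. Gallagher, L. Saint-Raymond, B. Texier, *From Newton to Boltzmann: hard spheres and
  short-range potentials*, EMS (2013) = arXiv:1208.5753, Part I Ch. 2 §3.1 (Thm 1), Part II
  Ch. 5 (Def. 5.1.4, §5.3–5.4, Thm 7).
* S. Ukai, *On the existence of global solutions of mixed problem for non-linear Boltzmann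
  equation*, Proc. Japan Acad. 50 (1974) 179–184.
* S. Kaniel, M. Shinbrot, *The Boltzmann equation. I. Uniqueness and local existence*,
  Comm. Math. Phys. 58 (1978) 65–84 (decaying Maxwellian weights).
-/

open MeasureTheory Metric Real Set Filter Topology
open scoped InnerProductSpace ENNReal
open Literature.Analysis.FluidPDE

namespace Literature.MathematicalPhysics.KineticTheory

noncomputable section

section Uniqueness

variable {d : Type*} [Fintype d]

/-- Increments of a mild solution along a characteristic: for `t₁, t ∈ [0, T]`,
`f♯(t, x, v) - f♯(t₁, x, v) = ∫_{t₁}^{t} Q(f,f)♯(τ, x, v) dτ` (difference of two instances of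
Duhamel's formula, GST 2013 §2.1). [cite: GST2013, Part I Ch. 2 §2.1] -/
theorem alongFlow_sub_alongFlow_eq_integral {X : Type*} {T : ℝ} {G : Geometry d X}
    {B : EuclideanSpace ℝ d × EuclideanSpace ℝ d → sphere (0 : EuclideanSpace ℝ d) 1 → ℝ}
    {f : ℝ → X → EuclideanSpace ℝ d → ℝ} (hf : IsMildBoltzmannSolutionOn T G B f) (x : X)
    (v : EuclideanSpace ℝ d) {t₁ t : ℝ} (ht₁ : t₁ ∈ Icc 0 T) (ht : t ∈ Icc 0 T) :
    alongFlow G f t x v - alongFlow G f t₁ x v =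
      ∫ τ in t₁..t, alongFlow G (collisionTerm B f) τ x v := by
  rw [hf.duhamel x v t ht, hf.duhamel x v t₁ ht₁, add_sub_add_left_eq_sub,
    intervalIntegral.integral_interval_sub_left (hf.intervalIntegrable x v t ht)
      (hf.intervalIntegrable x v t₁ ht₁)]

/-- **One step of the uniqueness argument** (Ukai's decaying-weight trick on the difference;
GST 2013 Part II Ch. 5 §5.4). In the setting of `hardSphere_mild_unique`, if `f(t₁) = g(t₁)`
for some `t₁ ∈ [0, T]` then `f(t) = g(t)` on `[t₁, min (t₁ + δ²) T]`, where `δ ∈ (0, 1]` is any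
number with `4 |S^{d-1}| J(β/2) N (1 + (2/(β/2))^{1/2}) δ ≤ 1/2`,
`J(β/2) = ∫ (1 + |u|) e^{-(β/2)|u|²/2} du`. [cite: GST2013, Part II Ch. 5 §5.4] -/
theorem hardSphere_mild_unique_step {T β N δ : ℝ} (hβ : 0 < β) (hN : 0 ≤ N)
    {f g : ℝ → UnitAddTorus d → EuclideanSpace ℝ d → ℝ}
    (hf : IsMildBoltzmannSolutionOn T (Torus.geometry d) hardSphereKernel f)
    (hg : IsMildBoltzmannSolutionOn T (Torus.geometry d) hardSphereKernel g)
    (hfc : ∀ t ∈ Icc 0 T, Continuous (Function.uncurry (f t)))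
    (hgc : ∀ t ∈ Icc 0 T, Continuous (Function.uncurry (g t)))
    (hfb : ∀ t ∈ Icc 0 T, ∀ x v, |f t x v| ≤ N * exp (-(β / 2) * ‖v‖ ^ 2))
    (hgb : ∀ t ∈ Icc 0 T, ∀ x v, |g t x v| ≤ N * exp (-(β / 2) * ‖v‖ ^ 2))
    (hδ0 : 0 < δ) (hδ1 : δ ≤ 1)
    (hδ : 4 * (sphereMeasure : Measure (sphere (0 : EuclideanSpace ℝ d) 1)).real univ *
        (∫ u : EuclideanSpace ℝ d, (1 + ‖u‖) * exp (-(β / 2 / 2) * ‖u‖ ^ 2)) * N *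
        (1 + Real.sqrt (2 / (β / 2))) * δ ≤ 1 / 2)
    {t₁ : ℝ} (ht₁ : t₁ ∈ Icc 0 T) (h1 : f t₁ = g t₁) :
    ∀ t ∈ Icc t₁ (min (t₁ + δ ^ 2) T), f t = g t := by
  -- constants
  set S : ℝ := (sphereMeasure : Measure (sphere (0 : EuclideanSpace ℝ d) 1)).real univ with hS
  set J : ℝ := ∫ u : EuclideanSpace ℝ d, (1 + ‖u‖) * exp (-(β / 2 / 2) * ‖u‖ ^ 2) with hJ
  set κ : ℝ := β / 2 with hκ_def
  have hκ : 0 < κ := by positivity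
  set ρ : ℝ := Real.sqrt (2 / κ) with hρ
  have hρ0 : 0 ≤ ρ := Real.sqrt_nonneg _
  have hS0 : 0 ≤ S := measureReal_nonneg
  have hJ0 : 0 ≤ J := integral_one_add_norm_mul_exp_nonneg (β / 2)
  set t₂ : ℝ := min (t₁ + δ ^ 2) T with ht₂
  have ht₂T : t₂ ≤ T := min_le_right _ _
  have hsub : Icc t₁ t₂ ⊆ Icc 0 T := Icc_subset_Icc ht₁.1 ht₂T
  -- the weight `γ(t) = β - κ (t - t₁)`
  set γ : ℝ → ℝ := fun t => β - κ * (t - t₁) with hγ_def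
  have hγ_le : ∀ t, t₁ ≤ t → γ t ≤ β := fun t ht => by
    simp only [hγ_def]
    nlinarith [mul_nonneg hκ.le (sub_nonneg.2 ht)]
  have hγ_ge : ∀ t ∈ Icc t₁ t₂, β / 2 ≤ γ t := fun t ht => by
    have h1 : t - t₁ ≤ 1 := by
      have := (ht.2.trans (min_le_left _ _))
      nlinarith
    simp only [hγ_def, hκ_def]
    nlinarith
  -- Gaussian bounds at the weight `γ t ≤ β`
  have hmono : ∀ t, t₁ ≤ t → ∀ w : EuclideanSpace ℝ d,
      N * exp (-(β / 2) * ‖w‖ ^ 2) ≤ N * exp (-(γ t / 2) * ‖w‖ ^ 2) := fun t ht w =>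
    mul_le_mul_of_nonneg_left (exp_le_exp.2 (by nlinarith [sq_nonneg ‖w‖, hγ_le t ht])) hN
  -- degenerate case `t₂ < t₁` is vacuous
  rcases lt_or_ge t₂ t₁ with h21 | ht₁₂
  · intro t ht
    exact absurd (ht.1.trans ht.2) (not_le.2 h21)
  -- the weighted functional on `[t₁, t₂] × T^d × ℝ^d`
  set P := (Icc t₁ t₂) × UnitAddTorus d × EuclideanSpace ℝ d
  set w : P → ℝ := fun p => exp (γ p.1 / 2 * ‖p.2.2‖ ^ 2) * |f p.1 p.2.1 p.2.2 - g p.1 p.2.1 p.2.2|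
    with hw_def
  have hw0 : ∀ p, 0 ≤ w p := fun p => by positivity
  have hw_bdd : ∀ p, w p ≤ 2 * N := by
    rintro ⟨⟨t, ht⟩, y, v⟩
    have htT : t ∈ Icc 0 T := hsub ht
    have hh : |f t y v - g t y v| ≤ 2 * N * exp (-(γ t / 2) * ‖v‖ ^ 2) := by
      calc |f t y v - g t y v| ≤ |f t y v| + |g t y v| := abs_sub _ _
        _ ≤ N * exp (-(γ t / 2) * ‖v‖ ^ 2) + N * exp (-(γ t / 2) * ‖v‖ ^ 2) :=
            add_le_add ((hfb t htT y v).trans (hmono t ht.1 v))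
              ((hgb t htT y v).trans (hmono t ht.1 v))
        _ = 2 * N * exp (-(γ t / 2) * ‖v‖ ^ 2) := by ring
    simp only [hw_def]
    calc exp (γ t / 2 * ‖v‖ ^ 2) * |f t y v - g t y v|
        ≤ exp (γ t / 2 * ‖v‖ ^ 2) * (2 * N * exp (-(γ t / 2) * ‖v‖ ^ 2)) :=
          mul_le_mul_of_nonneg_left hh (exp_pos _).le
      _ = 2 * N * (exp (-(γ t / 2) * ‖v‖ ^ 2) * exp (γ t / 2 * ‖v‖ ^ 2)) := by ring
      _ = 2 * N := by rw [exp_neg_weight_mul_exp_weight, mul_one]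
  haveI hP : Nonempty P := ⟨(⟨t₁, left_mem_Icc.2 ht₁₂⟩, 0, 0)⟩
  have hbdd : BddAbove (range w) := ⟨2 * N, by rintro _ ⟨p, rfl⟩; exact hw_bdd p⟩
  set M : ℝ := ⨆ p, w p with hM_def
  have hM_ge : ∀ p, w p ≤ M := fun p => le_ciSup hbdd p
  have hM0 : 0 ≤ M := (hw0 hP.some).trans (hM_ge _)
  have hM_pt : ∀ t (ht : t ∈ Icc t₁ t₂) (y : UnitAddTorus d) (v : EuclideanSpace ℝ d),
      |f t y v - g t y v| ≤ M * exp (-(γ t / 2) * ‖v‖ ^ 2) := by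
    intro t ht y v
    have h := hM_ge (⟨t, ht⟩, y, v)
    simp only [hw_def] at h
    calc |f t y v - g t y v|
        = exp (-(γ t / 2) * ‖v‖ ^ 2) * (exp (γ t / 2 * ‖v‖ ^ 2) * |f t y v - g t y v|) := by
          rw [← mul_assoc, exp_neg_weight_mul_exp_weight, one_mul]
      _ ≤ exp (-(γ t / 2) * ‖v‖ ^ 2) * M := mul_le_mul_of_nonneg_left h (exp_pos _).le
      _ = M * exp (-(γ t / 2) * ‖v‖ ^ 2) := mul_comm _ _
  -- the contraction: every value of `w` is at most `M / 2`
  have hclaim : ∀ p : P, w p ≤ M / 2 := by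
    rintro ⟨⟨t, ht⟩, y, v⟩
    have htT : t ∈ Icc 0 T := hsub ht
    -- foot of the characteristic through `(t, y, v)`
    set x : UnitAddTorus d := y - Literature.Analysis.FunctionSpaces.Torus.proj (t • v) with hx
    have hy : x + Literature.Analysis.FunctionSpaces.Torus.proj (t • v) = y := sub_add_cancel y _
    -- Duhamel increments of `f` and `g` on `[t₁, t]`
    have hDf := alongFlow_sub_alongFlow_eq_integral hf x v ht₁ htT
    have hDg := alongFlow_sub_alongFlow_eq_integral hg x v ht₁ htT
    have hflow : ∀ (u : ℝ → UnitAddTorus d → EuclideanSpace ℝ d → ℝ) (s : ℝ),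
        alongFlow (Torus.geometry d) u s x v =
          u s (x + Literature.Analysis.FunctionSpaces.Torus.proj (s • v)) v := fun u s => by
      simp only [alongFlow, Torus.geometry_translate]
    have hft : alongFlow (Torus.geometry d) f t x v = f t y v := by rw [hflow, hy]
    have hgt : alongFlow (Torus.geometry d) g t x v = g t y v := by rw [hflow, hy]
    have hfg₁ : alongFlow (Torus.geometry d) f t₁ x v = alongFlow (Torus.geometry d) g t₁ x v := by
      rw [hflow, hflow, h1]
    -- interval integrability on `[t₁, t]`
    have hIf : IntervalIntegrable
        (fun τ => alongFlow (Torus.geometry d) (collisionTerm hardSphereKernel f) τ x v)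
        volume t₁ t :=
      (hf.intervalIntegrable x v t₁ ht₁).symm.trans (hf.intervalIntegrable x v t htT)
    have hIg : IntervalIntegrable
        (fun τ => alongFlow (Torus.geometry d) (collisionTerm hardSphereKernel g) τ x v)
        volume t₁ t :=
      (hg.intervalIntegrable x v t₁ ht₁).symm.trans (hg.intervalIntegrable x v t htT)
    have hh_int : f t y v - g t y v = ∫ τ in t₁..t,
        (alongFlow (Torus.geometry d) (collisionTerm hardSphereKernel f) τ x v -
          alongFlow (Torus.geometry d) (collisionTerm hardSphereKernel g) τ x v) := by
      rw [intervalIntegral.integral_sub hIf hIg, ← hDf, ← hDg, hft, hgt, hfg₁]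
      ring
    -- the pointwise bound on the integrand, from the Gaussian Lipschitz estimate
    set b : ℝ → ℝ := fun τ => 4 * 1 * S * J * N * M *
      ((1 + ‖v‖) * exp (-((β - κ * (τ - t₁)) / 2) * ‖v‖ ^ 2)) with hb_def
    have hb_cont : Continuous b := by
      simp only [hb_def]
      fun_prop
    have hbound : ∀ τ ∈ Ioc t₁ t,
        ‖alongFlow (Torus.geometry d) (collisionTerm hardSphereKernel f) τ x v -
          alongFlow (Torus.geometry d) (collisionTerm hardSphereKernel g) τ x v‖ ≤ b τ := by
      intro τ hτ
      have hτ₁₂ : τ ∈ Icc t₁ t₂ := ⟨hτ.1.le, hτ.2.trans ht.2⟩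
      have hτT : τ ∈ Icc 0 T := hsub hτ₁₂
      set y' : UnitAddTorus d := x + Literature.Analysis.FunctionSpaces.Torus.proj (τ • v) with hy'
      have hpm : Measurable (f τ y') := (hfc τ hτT).measurable.comp measurable_prodMk_left
      have hqm : Measurable (g τ y') := (hgc τ hτT).measurable.comp measurable_prodMk_left
      have hp : ∀ w', |f τ y' w'| ≤ N * exp (-(γ τ / 2) * ‖w'‖ ^ 2) := fun w' =>
        (hfb τ hτT y' w').trans (hmono τ hτ.1.le w')
      have hq : ∀ w', |g τ y' w'| ≤ N * exp (-(γ τ / 2) * ‖w'‖ ^ 2) := fun w' =>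
        (hgb τ hτT y' w').trans (hmono τ hτ.1.le w')
      have hpq : ∀ w', |f τ y' w' - g τ y' w'| ≤ M * exp (-(γ τ / 2) * ‖w'‖ ^ 2) := fun w' =>
        hM_pt τ hτ₁₂ y' w'
      have hL := (collisionOpWith_lipschitz_gaussian (isGradCutoffKernel_hardSphereKernel)
        zero_le_one hardSphereKernel_le_one_mul (half_pos hβ) (hγ_ge τ hτ₁₂) hpm hqm hN hM0
        hp hq hpq v).1
      rw [Real.norm_eq_abs, hflow, hflow]
      simp only [collisionTerm]
      refine hL.trans (le_of_eq ?_)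
      simp only [hb_def, hγ_def, hS, hJ, hκ_def]
    -- integrate the bound
    have hint_le : |f t y v - g t y v| ≤ ∫ τ in t₁..t, b τ := by
      rw [hh_int, ← Real.norm_eq_abs]
      exact intervalIntegral.norm_integral_le_of_norm_le ht.1
        (Eventually.of_forall hbound) (hb_cont.intervalIntegrable _ _)
    have hweight := intervalIntegral_weight_le hκ β t₁ t ht.1 ‖v‖
    have hs0 : 0 ≤ t - t₁ := sub_nonneg.2 ht.1
    have hs1 : t - t₁ ≤ δ ^ 2 := by linarith [ht.2.trans (min_le_left _ _)]
    have hsmall : (t - t₁) + Real.sqrt (2 * (t - t₁) / κ) ≤ δ * (1 + ρ) := by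
      have h1 : t - t₁ ≤ δ := hs1.trans (by nlinarith)
      have h2 : Real.sqrt (2 * (t - t₁) / κ) ≤ δ * ρ := by
        rw [show 2 * (t - t₁) / κ = (t - t₁) * (2 / κ) by ring, Real.sqrt_mul hs0, hρ]
        refine mul_le_mul_of_nonneg_right ?_ (Real.sqrt_nonneg _)
        calc Real.sqrt (t - t₁) ≤ Real.sqrt (δ ^ 2) := Real.sqrt_le_sqrt hs1
          _ = δ := Real.sqrt_sq hδ0.le
      linarith
    have hI : ∫ τ in t₁..t, b τ ≤ M / 2 * exp (-(γ t / 2) * ‖v‖ ^ 2) := by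
      simp only [hb_def]
      rw [intervalIntegral.integral_const_mul]
      have hC0 : 0 ≤ 4 * 1 * S * J * N * M := by positivity
      calc 4 * 1 * S * J * N * M *
            ∫ τ in t₁..t, (1 + ‖v‖) * exp (-((β - κ * (τ - t₁)) / 2) * ‖v‖ ^ 2)
          ≤ 4 * 1 * S * J * N * M * (((t - t₁) + Real.sqrt (2 * (t - t₁) / κ)) *
              exp (-((β - κ * (t - t₁)) / 2) * ‖v‖ ^ 2)) :=
            mul_le_mul_of_nonneg_left hweight hC0
        _ ≤ 4 * 1 * S * J * N * M * ((δ * (1 + ρ)) *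
              exp (-((β - κ * (t - t₁)) / 2) * ‖v‖ ^ 2)) := by
            gcongr
        _ = (4 * S * J * N * (1 + ρ) * δ) * M * exp (-(γ t / 2) * ‖v‖ ^ 2) := by
            simp only [hγ_def]; ring
        _ ≤ (1 / 2) * M * exp (-(γ t / 2) * ‖v‖ ^ 2) := by
            have := hδ
            gcongr
        _ = M / 2 * exp (-(γ t / 2) * ‖v‖ ^ 2) := by ring
    -- read off the weighted bound
    simp only [hw_def]
    calc exp (γ t / 2 * ‖v‖ ^ 2) * |f t y v - g t y v|
        ≤ exp (γ t / 2 * ‖v‖ ^ 2) * (M / 2 * exp (-(γ t / 2) * ‖v‖ ^ 2)) :=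
          mul_le_mul_of_nonneg_left (hint_le.trans hI) (exp_pos _).le
      _ = M / 2 * (exp (-(γ t / 2) * ‖v‖ ^ 2) * exp (γ t / 2 * ‖v‖ ^ 2)) := by ring
      _ = M / 2 := by rw [exp_neg_weight_mul_exp_weight, mul_one]
  -- hence `M = 0` and `f = g` on `[t₁, t₂]`
  have hM_le : M ≤ M / 2 := ciSup_le hclaim
  have hM_zero : M ≤ 0 := by linarith
  intro t ht
  funext y v
  have h := hM_pt t ht y v
  have h0 : |f t y v - g t y v| ≤ 0 :=
    h.trans (mul_nonpos_of_nonpos_of_nonneg hM_zero (exp_pos _).le)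
  exact sub_eq_zero.1 (abs_nonpos_iff.1 h0)

/-- **Uniqueness of mild hard-sphere Boltzmann solutions in Lanford's class**
(Gallagher–Saint-Raymond–Texier 2013, Part I Ch. 2 §3.1 Thm 1: "a unique continuous solution
on `[0, T]`"; here in the wide class `L^∞([0,T]; X_β)`, by Ukai's decaying-weight argument of
Part II Ch. 5 applied to the difference of two solutions). Let `f, g` be mild solutions of the
hard-sphere Boltzmann equation on `T^d` on `[0, T]` with continuous time slices and
`|f(t, x, v)|, |g(t, x, v)| ≤ N e^{-β|v|²/2}` for `t ∈ [0, T]`, `β > 0`. If `f(0) = g(0)` then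
`f(t) = g(t)` for all `t ∈ [0, T]`. [cite: GST2013, Part I Ch. 2 §3.1 Thm 1] -/
theorem hardSphere_mild_unique {T β N : ℝ} (hβ : 0 < β)
    {f g : ℝ → UnitAddTorus d → EuclideanSpace ℝ d → ℝ}
    (hf : IsMildBoltzmannSolutionOn T (Torus.geometry d) hardSphereKernel f)
    (hg : IsMildBoltzmannSolutionOn T (Torus.geometry d) hardSphereKernel g)
    (hfc : ∀ t ∈ Icc 0 T, Continuous (Function.uncurry (f t)))
    (hgc : ∀ t ∈ Icc 0 T, Continuous (Function.uncurry (g t)))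
    (hfb : ∀ t ∈ Icc 0 T, ∀ x v, |f t x v| ≤ N * exp (-(β / 2) * ‖v‖ ^ 2))
    (hgb : ∀ t ∈ Icc 0 T, ∀ x v, |g t x v| ≤ N * exp (-(β / 2) * ‖v‖ ^ 2))
    (h0 : f 0 = g 0) : ∀ t ∈ Icc 0 T, f t = g t := by
  -- vacuous if `T < 0`
  rcases lt_or_ge T 0 with hT | hT
  · intro t ht
    exact absurd (ht.1.trans ht.2) (not_le.2 hT)
  -- `N ≥ 0`
  have hN : 0 ≤ N := by
    have h := hfb 0 ⟨le_rfl, hT⟩ (0 : UnitAddTorus d) (0 : EuclideanSpace ℝ d)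
    have h1 : (0 : ℝ) ≤ N * exp (-(β / 2) * ‖(0 : EuclideanSpace ℝ d)‖ ^ 2) :=
      (abs_nonneg _).trans h
    simpa using h1
  -- the step length `δ²`
  set A : ℝ := 4 * (sphereMeasure : Measure (sphere (0 : EuclideanSpace ℝ d) 1)).real univ *
    (∫ u : EuclideanSpace ℝ d, (1 + ‖u‖) * exp (-(β / 2 / 2) * ‖u‖ ^ 2)) * N *
    (1 + Real.sqrt (2 / (β / 2))) with hA_def
  have hA0 : 0 ≤ A := by
    have h1 : (0 : ℝ) ≤ (sphereMeasure : Measure (sphere (0 : EuclideanSpace ℝ d) 1)).real univ :=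
      measureReal_nonneg
    have h2 := integral_one_add_norm_mul_exp_nonneg (E := EuclideanSpace ℝ d) (β / 2)
    have h3 : 0 ≤ Real.sqrt (2 / (β / 2)) := Real.sqrt_nonneg _
    simp only [hA_def]
    positivity
  set δ : ℝ := 1 / (2 * A + 2) with hδ_def
  have hδ0 : 0 < δ := by simp only [hδ_def]; positivity
  have hδ1 : δ ≤ 1 := by
    simp only [hδ_def]
    rw [div_le_one (by positivity)]
    linarith
  have hδA : A * δ ≤ 1 / 2 := by
    simp only [hδ_def]
    rw [mul_one_div, div_le_iff₀ (by positivity)]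
    linarith
  have hδ : 4 * (sphereMeasure : Measure (sphere (0 : EuclideanSpace ℝ d) 1)).real univ *
      (∫ u : EuclideanSpace ℝ d, (1 + ‖u‖) * exp (-(β / 2 / 2) * ‖u‖ ^ 2)) * N *
      (1 + Real.sqrt (2 / (β / 2))) * δ ≤ 1 / 2 := hδA
  -- induction on the number of steps
  have key : ∀ k : ℕ, ∀ s ∈ Icc 0 (min ((k : ℝ) * δ ^ 2) T), f s = g s := by
    intro k
    induction k with
    | zero =>
      intro s hs
      have hs0 : s = 0 := le_antisymm (hs.2.trans ((min_le_left _ _).trans (by simp))) hs.1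
      rw [hs0, h0]
    | succ k ih =>
      intro s hs
      set t₁ : ℝ := min ((k : ℝ) * δ ^ 2) T with ht₁_def
      have ht₁ : t₁ ∈ Icc 0 T := ⟨le_min (by positivity) hT, min_le_right _ _⟩
      have h1 : f t₁ = g t₁ := ih t₁ ⟨ht₁.1, le_rfl⟩
      have hstep := hardSphere_mild_unique_step hβ hN hf hg hfc hgc hfb hgb hδ0 hδ1 hδ ht₁ h1
      rcases le_or_gt s t₁ with hst | hst
      · exact ih s ⟨hs.1, hst⟩
      · refine hstep s ⟨hst.le, ?_⟩
        -- `min ((k+1) δ², T) ≤ min (t₁ + δ², T)`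
        have hs2 : s ≤ min (((k : ℝ) + 1) * δ ^ 2) T := by
          simpa [Nat.cast_succ] using hs.2
        refine le_min ?_ (hs2.trans (min_le_right _ _))
        rcases le_or_gt ((k : ℝ) * δ ^ 2) T with hk | hk
        · have : t₁ = (k : ℝ) * δ ^ 2 := min_eq_left hk
          rw [this]
          linarith [hs2.trans (min_le_left _ _)]
        · have : t₁ = T := min_eq_right hk.le
          rw [this]
          linarith [hs2.trans (min_le_right _ _), sq_nonneg δ]
  intro t ht
  obtain ⟨k, hk⟩ := exists_nat_ge (T / δ ^ 2)
  refine key k t ⟨ht.1, le_min ?_ ht.2⟩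
  have hδ2 : 0 < δ ^ 2 := by positivity
  calc t ≤ T := ht.2
    _ = T / δ ^ 2 * δ ^ 2 := by field_simp
    _ ≤ (k : ℝ) * δ ^ 2 := mul_le_mul_of_nonneg_right hk hδ2.le

end Uniqueness

end

end Literature.MathematicalPhysics.KineticTheory
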